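import Summits.AtomisticToContinuum.Crystallization.Theorems.OverbindingBudgetRegistryCut

/-!
# OverbindingBudget · decomp-a2c lens-4 g33 — part XXI-S: the SQUARE registry (S-branch vocabulary of slot 7d) and registry algebra

Helper file under `--supports stmt-AtomisticToContinuum-31280` (RDEF = `Theses.OverbindingBudget.RobustDefectLimitWindows`); closes nothing.

WHY THIS FILE (minimal counterexample in normal form).  Part XX cut slot 7d `BasalReferenceW Λ₁ ρ₁` through R4 `CellPinningW Λ₁ s₁ s₂`
(every admissible configuration has a PINNED near-triangular cell: `‖a‖, ‖b‖` and `‖a − b‖` or `‖a + b‖` in `[s₁, s₂]`, box width `1 %`).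
lens-3's PROVED one-scale normal form `ChartedPlanarOrderStackedUniform.stackedUniform` (`aHi ≤ 8/7`; 7d's `IsCleanW` is `IsCleanP (103/100)`)
says an admissible stacked configuration is of exactly one of TWO types: (T) `95/289·‖a‖² ≤ |⟪a, b⟫|` (triangular close-packed layers) or
(S) `|⟪a, b⟫| ≤ 11/75·‖a‖²` (SQUARE layers, heights `∈ [8/17, 24/25]·‖a‖`).  The S type is inhabited by an admissible configuration:
zero-pressure fcc presented on its `{100}` planes — `a ⊥ b`, `‖a‖ = ‖b‖ = d⋆ ≈ 0.971 ≤ 17/16`, increments `≡ (a + b)/2 + (d⋆/√2) n`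
modulo the layer lattice; the set-level binders (`IsSep`, `IsCleanW`, `IsNash`, `StressFree`) are those the cell grants fcc, it is stacked with
independent periods, and every `{100}` gap transmits zero stress (cubic symmetry: `σ = −p·I`, `p(d⋆) = 0`).  For it `‖a ± b‖ = √2·d⋆ ≈ 1.373
∉ [s₁, s₂]`, so R4 as typed is FALSE (refuted in evidence; class `misstated`), and with it R3/R5's `Pinned` hypothesis never fires on S-type
configurations: the registry cut of record covers the T branch only.  7a `StackedReductionW` cannot be strengthened to exclude S (a clean-W
square stacking with per-layer wobble has no triangular re-presentation), so S must be carried INSIDE 7d.  Part XXI-D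
(`OverbindingBudgetRegistryDichotomy`) re-types R4 as the dichotomy R4′ `Pinned ∨ PinnedSq` (cut PROVED from `stackedUniform` into R4T ∧ R4S)
and adds the S branch; this file supplies the S-branch vocabulary and the algebra both branches use, all PROVED and unconditional
(junk value `0` of `tsum` matched on both sides wherever a lattice sum diverges):

* `holSq a b = (a + b)/2` (the unique deep hole of a square cell), `regSq a b c u v m = c + u m • a + v m • b` (the ONE-valued square
  registry profile — a square layer has one hollow coset, so there is no coset sequence and no span-`≥ 2` modulation), `IsSqBalanced a b n c`
  (height `≥ 1/2`, lateral part EXACTLY `holSq a b`, `unifStress a b c = 0`), `PinnedSq t₁ t₂ a b` (sides in `[t₁, t₂]`, both diagonals in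
  `√2·[t₁, t₂]`).
* REGISTRY ALGEBRA: `rotPi n` is additive, homogeneous, norm-preserving (`‖n‖ = 1`) and commutes with `pairForce`;
  `‖reg a b n c σ u v m − reg a b n c′ σ u v m‖ = ‖c − c′‖` (T-branch re-centring), `regSq … c … m − regSq … c′ … m = c − c′`.
* ZERO GAP STRESS OF THE SQUARE REGISTRY (exact, no residual): `layerForce` is periodic under the layer lattice (`layerForce_add_lattice`),
  `gapStress a b m (regSq a b c u v) = unifStress a b c` (`gapStress_regSq`: lattice drifts drop out, the straddle types of all gaps are
  equivalent by the index shift) — so a square-balanced `c` gives a profile with ALL gap stresses zero.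
* LATERAL BALANCE IS AUTOMATIC on the line `holSq a b + ℝ n` for EVERY cell (not only exact squares): the inversion `(i, j) ↦ (s − i, s − j)`
  of `ℤ²` realises the half-turn `rotPi n` on the relative-position family of the uniform stack, so `rotPi n (unifStress a b c) = unifStress a b c`,
  i.e. `unifStress a b c = ⟪unifStress a b c, n⟫ • n` (`unifStress_eq_normal_sq`); square balance is ONE scalar equation in the height
  (`isSqBalanced_of_normal`) — the S-branch existence problem is one-dimensional (IVT), cf. XXI-D's `SqBalancedHeight`.
-/

noncomputable section

namespace Summit.AtomisticToContinuum.Crystallization.Theorems.OverbindingBudgetRegistrySquare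

open Metric
open scoped RealInnerProductSpace
open Summit.AtomisticToContinuum.Crystallization.Theorems.ChartedPlanarOrderChunkFloor (E3)
open Summit.AtomisticToContinuum.Crystallization.Theorems.ChartedPlanarOrderProfileSlavingLJ (pairForce layerForce IsStacked gapStress incr
  offsetOf Straddle)
open Summit.AtomisticToContinuum.Crystallization.Theorems.OverbindingBudgetRegistryCut (rotPi hol unifStress IsUnitNormal reg
  inner_reg isStacked_of_near_reg)

/-! ## §1 The square registry vocabulary -/

/-- the square hollow: the centre of the in-plane cell `(a, b)` — the unique deep hole (per cell) of a square layer. -/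
def holSq (a b : E3) : E3 := (1 / 2 : ℝ) • (a + b)

/-- **square-balanced increment**: height `≥ 1/2` along `n`, lateral part EXACTLY the square hollow, and the uniform stack with increment `c`
transmits no stress (by `unifStress_eq_normal_sq` only the normal component is a condition). -/
def IsSqBalanced (a b n c : E3) : Prop := 1 / 2 ≤ ⟪c, n⟫ ∧ c - ⟪c, n⟫ • n = holSq a b ∧ unifStress a b c = 0

/-- **the one-valued square registry profile** with lattice drifts `u, v`. -/
def regSq (a b c : E3) (u v : ℤ → ℤ) (m : ℤ) : E3 := c + (((u m : ℤ) : ℝ) • a + ((v m : ℤ) : ℝ) • b)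

/-- **pinned square cell**: sides `‖a‖, ‖b‖ ∈ [t₁, t₂]` and both diagonals `‖a ± b‖ ∈ √2·[t₁, t₂]` (squared form). -/
def PinnedSq (t₁ t₂ : ℝ) (a b : E3) : Prop :=
  t₁ ≤ ‖a‖ ∧ ‖a‖ ≤ t₂ ∧ t₁ ≤ ‖b‖ ∧ ‖b‖ ≤ t₂ ∧ 2 * t₁ ^ 2 ≤ ‖a + b‖ ^ 2 ∧ ‖a + b‖ ^ 2 ≤ 2 * t₂ ^ 2 ∧
    2 * t₁ ^ 2 ≤ ‖a - b‖ ^ 2 ∧ ‖a - b‖ ^ 2 ≤ 2 * t₂ ^ 2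

/-! ## §2 Registry algebra: the half-turn, re-centring, heights -/

/-- `rotPi n` is additive. [folklore] -/
theorem rotPi_add (n x y : E3) : rotPi n (x + y) = rotPi n x + rotPi n y := by
  unfold rotPi
  rw [inner_add_left, mul_add, add_smul]
  abel

/-- `rotPi n` is homogeneous. [folklore] -/
theorem rotPi_smul (n : E3) (r : ℝ) (x : E3) : rotPi n (r • x) = r • rotPi n x := by
  unfold rotPi
  rw [real_inner_smul_left, smul_sub, smul_smul, show r * (2 * ⟪x, n⟫) = 2 * (r * ⟪x, n⟫) from by ring]

/-- `rotPi n (−x) = −rotPi n x`. [folklore] -/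
theorem rotPi_neg (n x : E3) : rotPi n (-x) = -rotPi n x := by
  rw [← neg_one_smul ℝ x, rotPi_smul, neg_one_smul]

/-- `rotPi n (x − y) = rotPi n x − rotPi n y`. [folklore] -/
theorem rotPi_sub (n x y : E3) : rotPi n (x - y) = rotPi n x - rotPi n y := by
  rw [sub_eq_add_neg, rotPi_add, rotPi_neg, ← sub_eq_add_neg]

/-- `rotPi n` preserves norms for a unit `n`. [folklore] -/
theorem norm_rotPi {n : E3} (hn : ‖n‖ = 1) (x : E3) : ‖rotPi n x‖ = ‖x‖ := by
  have h : ‖rotPi n x‖ ^ 2 = ‖x‖ ^ 2 := by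
    unfold rotPi
    rw [norm_sub_sq_real, norm_smul, hn, mul_one, real_inner_smul_left, real_inner_comm x n, Real.norm_eq_abs, sq_abs]
    ring
  exact (pow_left_inj₀ (norm_nonneg _) (norm_nonneg _) two_ne_zero).1 h

/-- the pair force commutes with the half-turn (central force). [folklore] -/
theorem pairForce_rotPi {n : E3} (hn : ‖n‖ = 1) (x : E3) : pairForce (rotPi n x) = rotPi n (pairForce x) := by
  unfold pairForce
  rw [norm_rotPi hn, rotPi_smul]

/-- **re-centring the two-valued registry**: `‖reg … c … m − reg … c′ … m‖ = ‖c − c′‖` (unit `n`). [this file] -/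
theorem norm_reg_sub_reg {a b n : E3} (hn : ‖n‖ = 1) (c c' : E3) (σ : ℤ → Bool) (u v : ℤ → ℤ) (m : ℤ) :
    ‖reg a b n c σ u v m - reg a b n c' σ u v m‖ = ‖c - c'‖ := by
  unfold reg
  rw [add_sub_add_right_eq_sub]
  split_ifs
  · rfl
  · rw [← rotPi_sub, norm_rotPi hn]

/-- re-centring the square registry: `regSq … c … m − regSq … c′ … m = c − c′`. [this file] -/
theorem regSq_sub_regSq (a b c c' : E3) (u v : ℤ → ℤ) (m : ℤ) : regSq a b c u v m - regSq a b c' u v m = c - c' := by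
  unfold regSq
  rw [add_sub_add_right_eq_sub]

/-- the square registry profile is the two-valued one with the constant coset sequence. [this file] -/
theorem reg_true (a b n c : E3) (u v : ℤ → ℤ) : reg a b n c (fun _ => true) u v = regSq a b c u v := by
  funext m
  unfold reg regSq
  rw [if_pos rfl]

/-- every value of the square registry profile has `n`-component `⟪c, n⟫`. [this file] -/
theorem inner_regSq {a b n c : E3} (hn : IsUnitNormal a b n) (u v : ℤ → ℤ) (m : ℤ) : ⟪n, regSq a b c u v m⟫ = ⟪c, n⟫ := by
  rw [← reg_true a b n c u v]
  exact inner_reg hn _ u v m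

/-- an offset profile whose increments are within `t < 1/2` of a square registry profile (height `≥ 1/2`) is stacked along `n`. [this file] -/
theorem isStacked_of_near_regSq {a b n c : E3} {u v : ℤ → ℤ} {w' : ℤ → E3} {t : ℝ} (hn : IsUnitNormal a b n) (hc : 1 / 2 ≤ ⟪c, n⟫)
    (hw : ∀ k, ‖incr w' k - regSq a b c u v k‖ ≤ t) (ht : t < 1 / 2) : IsStacked a b w' :=
  isStacked_of_near_reg (σ := fun _ => true) hn hc (fun k => by rw [reg_true]; exact hw k) ht

/-- the height of `holSq a b + h • n` is `h`. [this file] -/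
theorem inner_holSq_height {a b n : E3} (hn : IsUnitNormal a b n) (h : ℝ) : ⟪holSq a b + h • n, n⟫ = h := by
  obtain ⟨h1, ha, hb⟩ := hn
  unfold holSq
  rw [inner_add_left, real_inner_smul_left, real_inner_smul_left, inner_add_left, real_inner_comm n a, real_inner_comm n b, ha, hb,
    real_inner_self_eq_norm_sq, h1]
  ring

/-- the lateral part of `holSq a b + h • n` is `holSq a b`. [this file] -/
theorem lateral_holSq_height {a b n : E3} (hn : IsUnitNormal a b n) (h : ℝ) :
    (holSq a b + h • n) - ⟪holSq a b + h • n, n⟫ • n = holSq a b := by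
  rw [inner_holSq_height hn h, add_sub_cancel_right]

/-- `‖(x + h • n) − (x + h′ • n)‖ = |h − h′|` for a unit `n`. [folklore] -/
theorem norm_height_sub {n : E3} (hn : ‖n‖ = 1) (x : E3) (h h' : ℝ) : ‖(x + h • n) - (x + h' • n)‖ = |h - h'| := by
  rw [add_sub_add_left_eq_sub, ← sub_smul, norm_smul, hn, mul_one, Real.norm_eq_abs]

/-! ## §3 Lattice periodicity; the gap stresses of the square registry profile -/

/-- **the layer force is periodic under the layer lattice** (unconditional: translation is a bijection of `ℤ²`). [this file] -/
theorem layerForce_add_lattice (a b v : E3) (i j : ℤ) :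
    layerForce a b (v + (((i : ℤ) : ℝ) • a + ((j : ℤ) : ℝ) • b)) = layerForce a b v := by
  unfold layerForce
  refine Eq.trans ?_ ((Equiv.addRight ((i, j) : ℤ × ℤ)).tsum_eq fun ij : ℤ × ℤ => pairForce (v + ((ij.1 : ℝ) • a + (ij.2 : ℝ) • b)))
  refine tsum_congr fun ij => ?_
  simp only [Equiv.coe_addRight, Prod.fst_add, Prod.snd_add, Int.cast_add, add_smul]
  congr 1
  abel

/-- the offset of a constant increment profile: `offsetOf (fun _ ↦ c) k l = #(k, l] • c`. [this file] -/
theorem offsetOf_const (c : E3) (k l : ℤ) : offsetOf (fun _ => c) k l = (l - k).toNat • c := by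
  unfold offsetOf
  rw [Finset.sum_const, Int.card_Ioc]

/-- the offsets of the square registry profile are those of the constant profile `c` up to layer-lattice vectors. [this file] -/
theorem offsetOf_regSq (a b c : E3) (u v : ℤ → ℤ) (k l : ℤ) :
    offsetOf (regSq a b c u v) k l = offsetOf (fun _ => c) k l +
      ((((∑ i ∈ Finset.Ioc k l, u i : ℤ)) : ℝ) • a + (((∑ i ∈ Finset.Ioc k l, v i : ℤ)) : ℝ) • b) := by
  unfold offsetOf regSq
  rw [Finset.sum_add_distrib, Finset.sum_add_distrib, Int.cast_sum, Int.cast_sum, Finset.sum_smul, Finset.sum_smul]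

/-- hence the layer forces across the square registry profile are those across the constant profile. [this file] -/
theorem layerForce_offsetOf_regSq (a b c : E3) (u v : ℤ → ℤ) (k l : ℤ) :
    layerForce a b (-(offsetOf (regSq a b c u v) k l)) = layerForce a b (-(offsetOf (fun _ => c) k l)) := by
  rw [offsetOf_regSq, neg_add, ← layerForce_add_lattice a b (-(offsetOf (fun _ => c) k l)) (-(∑ i ∈ Finset.Ioc k l, u i))
    (-(∑ i ∈ Finset.Ioc k l, v i)), Int.cast_neg, Int.cast_neg, neg_smul, neg_smul, neg_add]

/-- the straddle types of two gaps are equivalent by the index shift (which preserves `l − k`). [this file] -/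
def straddleShift (m : ℤ) : Straddle m ≃ Straddle 0 where
  toFun p := ⟨(p.1.1 - m, p.1.2 - m), ⟨by show p.1.1 - m < 0; have := p.2.1; omega, by show (0 : ℤ) ≤ p.1.2 - m; have := p.2.2; omega⟩⟩
  invFun q := ⟨(q.1.1 + m, q.1.2 + m), ⟨by show q.1.1 + m < m; have := q.2.1; omega, by show m ≤ q.1.2 + m; have := q.2.2; omega⟩⟩
  left_inv p := Subtype.ext (Prod.ext (by simp) (by simp))
  right_inv q := Subtype.ext (Prod.ext (by simp) (by simp))

/-- the gap stress of a constant increment profile is the same across every gap: `gapStress a b m (fun _ ↦ c) = unifStress a b c`. [this file] -/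
theorem gapStress_const (a b c : E3) (m : ℤ) : gapStress a b m (fun _ => c) = unifStress a b c := by
  unfold unifStress gapStress
  refine Eq.trans ?_ ((straddleShift m).tsum_eq fun q : Straddle 0 => layerForce a b (-(offsetOf (fun _ => c) q.1.1 q.1.2)))
  refine tsum_congr fun p => ?_
  simp only [offsetOf_const, straddleShift, Equiv.coe_fn_mk, sub_sub_sub_cancel_right]

/-- ★ **the square registry profile transmits the uniform-stack stress across EVERY gap**: `gapStress a b m (regSq a b c u v) = unifStress a b c`
(lattice drifts drop out by periodicity; unconditional). In particular a square-balanced `c` gives zero gap stress everywhere. [this file] -/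
theorem gapStress_regSq (a b c : E3) (u v : ℤ → ℤ) (m : ℤ) : gapStress a b m (regSq a b c u v) = unifStress a b c := by
  rw [← gapStress_const a b c m]
  unfold gapStress
  exact tsum_congr fun p => layerForce_offsetOf_regSq a b c u v p.1.1 p.1.2

/-! ## §4 Lateral balance on the square-hollow line is automatic (the half-turn symmetry) -/

/-- a continuous additive map that permutes the terms of a family fixes its sum (unconditional: summability is invariant). [folklore] -/
theorem map_tsum_eq_of_perm {ι : Type*} (φ : E3 →+ E3) (hφ : Continuous φ) {f : ι → E3} (e : ι ≃ ι)
    (h : ∀ i, φ (f i) = f (e i)) : φ (∑' i, f i) = ∑' i, f i := by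
  by_cases hs : Summable f
  · rw [← (hs.hasSum.map φ hφ).tsum_eq]
    exact (tsum_congr h).trans (e.tsum_eq f)
  · rw [tsum_eq_zero_of_not_summable hs, map_zero]

/-- the half-turn as an additive map. -/
def rotPiHom (n : E3) : E3 →+ E3 := AddMonoidHom.mk' (rotPi n) (rotPi_add n)

/-- `rotPiHom n x = rotPi n x`. -/
theorem rotPiHom_apply (n x : E3) : rotPiHom n x = rotPi n x := rfl

/-- the half-turn is continuous. [folklore] -/
theorem continuous_rotPiHom (n : E3) : Continuous (rotPiHom n) := by
  show Continuous fun c : E3 => (2 * ⟪c, n⟫) • n - c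
  fun_prop

/-- the half-turn fixes a lattice sum whose terms it permutes. [this file] -/
theorem rotPi_tsum_eq_of_perm {ι : Type*} (n : E3) {f : ι → E3} (e : ι ≃ ι) (h : ∀ i, rotPi n (f i) = f (e i)) :
    rotPi n (∑' i, f i) = ∑' i, f i :=
  (rotPiHom_apply n _).symm.trans
    (map_tsum_eq_of_perm (rotPiHom n) (continuous_rotPiHom n) (f := f) e fun i => (rotPiHom_apply n (f i)).trans (h i))

/-- the inversion `(i, j) ↦ (s − i, s − j)` of `ℤ²`. -/
def sqPerm (s : ℤ) : ℤ × ℤ ≃ ℤ × ℤ where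
  toFun p := (s - p.1, s - p.2)
  invFun p := (s - p.1, s - p.2)
  left_inv p := by simp
  right_inv p := by simp

/-- for an increment `c` centred over the square hollow (`c − ⟪c, n⟫ n = holSq a b`) the half-turn maps the relative-position family of the
uniform stack to itself: `rotPi n (−s c + i a + j b) = −s c + (s − i) a + (s − j) b`. [this file] -/
theorem rotPi_sqFamily {a b n c : E3} (hn : IsUnitNormal a b n) (hc : c - ⟪c, n⟫ • n = holSq a b) (s i j : ℤ) :
    rotPi n (-((s : ℝ) • c) + (((i : ℤ) : ℝ) • a + ((j : ℤ) : ℝ) • b)) =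
      -((s : ℝ) • c) + ((((s - i : ℤ)) : ℝ) • a + (((s - j : ℤ)) : ℝ) • b) := by
  obtain ⟨h1, ha, hb⟩ := hn
  have hx : ⟪-((s : ℝ) • c) + (((i : ℤ) : ℝ) • a + ((j : ℤ) : ℝ) • b), n⟫ = -((s : ℝ) * ⟪c, n⟫) := by
    rw [inner_add_left, inner_add_left, inner_neg_left, real_inner_smul_left, real_inner_smul_left, real_inner_smul_left,
      real_inner_comm n a, real_inner_comm n b, ha, hb, mul_zero, mul_zero, add_zero, add_zero]
  have ht : ⟪c, n⟫ • n = c - (1 / 2 : ℝ) • (a + b) := by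
    rw [← holSq, ← hc]
    abel
  unfold rotPi
  rw [hx, show (2 * -((s : ℝ) * ⟪c, n⟫)) = (-(2 * (s : ℝ))) * ⟪c, n⟫ from by ring, ← smul_smul, ht, Int.cast_sub, Int.cast_sub]
  module

/-- hence the layer force at every relative offset `−s c` (`s ∈ ℤ`) of the uniform stack is fixed by the half-turn. [this file] -/
theorem rotPi_layerForce_sq {a b n c : E3} (hn : IsUnitNormal a b n) (hc : c - ⟪c, n⟫ • n = holSq a b) (s : ℤ) :
    rotPi n (layerForce a b (-((s : ℝ) • c))) = layerForce a b (-((s : ℝ) • c)) := by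
  unfold layerForce
  refine rotPi_tsum_eq_of_perm n (sqPerm s) fun ij => ?_
  show rotPi n (pairForce (-((s : ℝ) • c) + (((ij.1 : ℤ) : ℝ) • a + ((ij.2 : ℤ) : ℝ) • b))) =
    pairForce (-((s : ℝ) • c) + ((((s - ij.1 : ℤ)) : ℝ) • a + (((s - ij.2 : ℤ)) : ℝ) • b))
  rw [← rotPi_sqFamily hn hc s ij.1 ij.2, pairForce_rotPi hn.1]

/-- … and so is the uniform-stack stress: `rotPi n (unifStress a b c) = unifStress a b c`. [this file] -/
theorem rotPi_unifStress_sq {a b n c : E3} (hn : IsUnitNormal a b n) (hc : c - ⟪c, n⟫ • n = holSq a b) :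
    rotPi n (unifStress a b c) = unifStress a b c := by
  unfold unifStress gapStress
  refine rotPi_tsum_eq_of_perm n (Equiv.refl _) fun p => ?_
  show rotPi n (layerForce a b (-(offsetOf (fun _ => c) p.1.1 p.1.2))) = layerForce a b (-(offsetOf (fun _ => c) p.1.1 p.1.2))
  rw [offsetOf_const, ← Nat.cast_smul_eq_nsmul ℝ, ← Int.cast_natCast, rotPi_layerForce_sq hn hc]

/-- ★ **lateral balance is automatic**: the uniform-stack stress of a square-hollow-centred increment is NORMAL,
`unifStress a b c = ⟪unifStress a b c, n⟫ • n` — for EVERY cell `(a, b)`, square or not. [this file] -/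
theorem unifStress_eq_normal_sq {a b n c : E3} (hn : IsUnitNormal a b n) (hc : c - ⟪c, n⟫ • n = holSq a b) :
    unifStress a b c = ⟪unifStress a b c, n⟫ • n := by
  have h := rotPi_unifStress_sq hn hc
  unfold rotPi at h
  rw [sub_eq_iff_eq_add] at h
  calc unifStress a b c = (1 / 2 : ℝ) • (unifStress a b c + unifStress a b c) := by
        rw [← two_smul ℝ (unifStress a b c), smul_smul]
        norm_num
    _ = ⟪unifStress a b c, n⟫ • n := by
        rw [← h, smul_smul, show (1 / 2 : ℝ) * (2 * ⟪unifStress a b c, n⟫) = ⟪unifStress a b c, n⟫ from by ring]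

/-- ★ **square balance is one scalar equation**: height `≥ 1/2`, lateral part `holSq a b`, and vanishing NORMAL uniform-stack stress give
`IsSqBalanced a b n c`. [this file] -/
theorem isSqBalanced_of_normal {a b n c : E3} (hn : IsUnitNormal a b n) (hh : 1 / 2 ≤ ⟪c, n⟫) (hc : c - ⟪c, n⟫ • n = holSq a b)
    (hz : ⟪unifStress a b c, n⟫ = 0) : IsSqBalanced a b n c :=
  ⟨hh, hc, by rw [unifStress_eq_normal_sq hn hc, hz, zero_smul]⟩

end Summit.AtomisticToContinuum.Crystallization.Theorems.OverbindingBudgetRegistrySquare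

end
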